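import Mathlib
import HarnessLib

/-!
# Gelbart–Rogawski 1991: the discrete members of Rogawski's A-packets `Π(ρ)` on the quasi-split
# `U(3)` are exactly the Weil representations `ω(γ, ψ, χ)` — Theorems 2.4.1, 3.4, 5.1.1 as a typed
# dictionary, with the Introduction's form of the main theorem proved from them

Reproduction (typed skeleton, DICTIONARY LEVEL — read "Transcription level" below) of: S. Gelbart,
J. Rogawski, *L-functions and Fourier–Jacobi coefficients for the unitary group `U(3)`*, Invent.
Math. **105** (1991) 445–472 [GelbartRogawski1991]: the Introduction's parametrisation
(pp. 446–448), Theorem 2.4.1 (p. 452), Theorem 3.4 with Proposition 3.4.1 and the Remarks of §3.2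
(pp. 457–461), and THE MAIN THEOREM 5.1.1 (p. 465).  Every quotation below was read on the page
images of the printed article ("p. N Lk" = printed page, approximate line).  `[R]` in the quotations
is J. Rogawski, *Automorphic representations of unitary groups in three variables*, Ann. of Math.
Stud. 123 (1990) [Rogawski1990]; `[R₂]` is J. Rogawski, *The multiplicity formula for A-packets*
(CRM Montréal 1992) [Rogawski1992], cited on p. 446 as "[R₂, Theorem 1.1]" (in press at the time).

GENERALITY — READ THIS FIRST.  [GelbartRogawski1991, §1.1, p. 449]: "`E/F` = quadratic extension of
number fields … `U(n)` will denote a quasi-split unitary group in `n` variables. … For `n = 3`, we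
fix `Φ = antidiag(1, ξ, −1)` where `ξ ∈ E*`, `Tr_{E/F}(ξ) = 0` and denote by `G` the (quasi-split)
unitary group of the skew-Hermitian form `Φ`."  Every statement below is about THIS `G` (the proofs
use the `F`-rational Borel subgroup `B` of `G`, the Heisenberg group `N`, Fourier–Jacobi
coefficients along the centre `U` of `N`, and the Shimura integral — §§2, 4).  An inner form `G′`
that is anisotropic (e.g. the unitary group of a hermitian space over a CM field that is definite
at some real place, [Rogawski1990] §14.2) is NOT covered by the global statements as printed; what
the paper says PLACE BY PLACE does apply to such a `G′` at the places `v` where `G′_v ≅ G_v`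
(Lemma 5.1.2, p. 466, is local) — that local statement is typed separately in
`Literature/NumberTheory/GelbartRogawski1991/LocalAPackets.lean`.

## Transcription level

Mathlib has no automorphic representations, no Weil representation and no A-packets.  As in
`Literature.RepresentationTheory.BorelWallach2000.SUn1Table`, the objects the printed statements
quantify over are POSITED as the fields of one dictionary `GR91Spectrum` (types, functions, the
group structure of the automorphic characters of `U(1)` and their printed action `γ ↦ γ ν_E` on the
splitting characters; no propositional field), and every printed statement is a predicate
`def … (X : GR91Spectrum) : Prop` whose docstring starts with its class: **P** = VERBATIM quotation
of a printed statement with its locator; **P-INTRO** = a sentence of the Introduction printed as a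
consequence of the paper's results and of [R], not a numbered theorem; **K** = PROVED here from the
P items by elementary logic.  NOTHING IS ASSERTED: a consumer supplies the dictionary from its own
model and takes `(h : X.thm511)` as an explicit hypothesis.  Fixed data of the intended meaning
that do not appear as fields: `E/F`, the additive character conventions, the character `μ` of
`C_E` with `μ|_{C_F} = ω_{E/F}` fixing `ξ_H : ᴸH → ᴸG` (§1.4, p. 450), the trace-zero `ξ ∈ E*`.

P items: `weil_discrete` (p. 446 L17–18 with Prop 3.4.1, p. 459), `thm34a` (Thm 3.4 (a),
p. 461), `weil_eq_iff` (p. 447 L6–8 = Remark p. 461), `thm511` (Thm 5.1.1, p. 465: (a) ⟺ (c) for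
discrete `π`, and the relation (5.1.1)); with the posited predicate `IsExceptional` (Def 2.3.1,
p. 452): `thm34b` (Thm 3.4 (b)), `thm241` (Thm 2.4.1, p. 452), `thm511_b` (Thm 5.1.1
(a) ⟺ (b) ⟺ (c)).  P-INTRO: `intro_h1_weil` (p. 448 L30–33).  K: `weil_mem_packetA`,
`exists_weil_of_mem`, `discreteMembers_eq` — which IS the Introduction's sentence p. 447 L11–14 —,
`exists_packet_and_weil_of_h1`, `weil_iff_mem_of_thm511_b`, `thm241_of_thm511_b`.

NOT here: the Weil representation itself, the Fourier–Jacobi / Shimura-integral machinery of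
§§2, 4, the `L`-function results (Thm 4.6.1 ff.), Lemma 5.1.2 (the sibling file), anything about
inner forms.

## References

* S. Gelbart, J. Rogawski, Invent. Math. 105 (1991) 445–472, doi 10.1007/BF01232276.
  [GelbartRogawski1991]
* J. Rogawski, Ann. of Math. Stud. 123, Princeton UP (1990) (= [R]). [Rogawski1990]
* J. Rogawski, *The multiplicity formula for A-packets*, in: The zeta functions of Picard modular
  surfaces, CRM Montréal (1992) 395–419 (= [R₂]; cited through p. 446). [Rogawski1992]
-/

noncomputable section

namespace Literature.NumberTheory.GelbartRogawski1991

universe u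

/-- **Posited primitives** for [GelbartRogawski1991] (quasi-split `G = U(3)` attached to a
quadratic extension `E/F` of number fields, `μ` and `ξ_H` fixed as in §1.4).  Intended meaning:
* `Rep` — isomorphism classes of irreducible admissible representations `π = ⊗_v π_v` of `G(𝔸)`
  (§1.2, p. 450: "All representations will tacitly be assumed admissible");
* `IsDiscrete π` — "discrete (i.e., occurs discretely in `L²(G(F)\G(𝔸))`)" (p. 446 L9–10);
* `IsExceptional π` — Definition 2.3.1, p. 452: "A discrete representation `(π, V)` is called
  exceptional if the following two conditions hold: (1) `Λ(π)` is a single `B(F)`-orbit. (2) For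
  each `φ ∈ V`, `φ_U = φ_N`." (`Λ(π)` the Fourier–Jacobi support of `π` along the Heisenberg
  radical, §2.3; `φ_U`, `φ_N` the constant terms, §2.1);
* `H1Nonzero π` — "`H¹(Lie(U), K, π_∞) ≠ 0`" (p. 448 L28–31; `U = U(3)`);
* `Char1` — "automorphic characters of `U(1)`", `U(1)` "the algebraic group associated to `E¹`"
  (§1.1, p. 449), i.e. characters of `E¹\𝔸_E¹`; these are the `η`, `η′` of `ρ` (§1.4) and the
  central characters `χ` ("The center `Z` of `G` is isomorphic to `U(1)`, and for each automorphic
  character `χ` of `U(1)` …", p. 446 L36–38), with their (commutative) group structure;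
* `OmegaHecke` — Hecke characters `γ` of `I_E` "whose restriction to `I_F` is `ω_{E/F}`" (p. 447
  L1–2; §3.2 Remark (1), p. 457); these index the compatible splittings `s = s(ψ, γ)` of
  `G(𝔸) → Mp_𝔸(W)` (Prop 3.1.1, p. 455; Remark p. 457: "a choice of `s` is equivalent to a choice
  of Hecke character of `E` whose restriction to `F` is `ω_{E/F}`, once `ψ` is fixed");
* the action `ν • γ` of `Char1` on `OmegaHecke` — `γ ↦ γ ν_E`, `ν_E(α) = ν(α/ᾱ)` "the base change
  of `ν` to `GL_{1/E}`" (§1.2, p. 450); p. 457 Remark (1) – p. 458 L1: "If `γ*` is any other Hecke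
  character with this property, then `γ* = γ ν_E`, where `ν` is an automorphic character of `U₁`";
  so `(η * η′) • μ = μ η_E η′_E`;
* `mu` — the fixed `μ` (§1.4, p. 450: "Fix a character `μ` of the idele class group `C_E` whose
  restriction to `C_F` is the character `ω_{E/F}` … The choice of `μ` fixes an embedding of
  L-groups `ξ_H : ᴸH → ᴸG`");
* `res1 γ` — "`γ¹` is the restriction of `γ` to the norm one elements" (Thm 5.1.1, p. 465);
* `AddChar` — non-trivial characters `ψ` of `F\𝔸` (§1.1); `NormClassEq ψ ψ′` — `ψ′ = ψ^δ` for some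
  `δ ∈ N_{E/F}(E*)`, where "`δ ∈ F*` act[s] on the set of characters of `F\𝔸` by setting
  `ψ^δ(x) = ψ(δx)`" (p. 447 L4–6);
* `weil γ ψ χ` — the **Weil representation** `ω(γ, ψ, χ)`: §3.4, pp. 459–460: "If `χ` is an
  automorphic character of the center `Z` of `G`, let `Θ(γ, ψ, χ)` denote the `χ`-eigenspace of
  `Θ(γ, ψ)`" (the space of theta series `θ_{Φ,s}(g) = θ(ω_ψ(s(g))Φ)`, `s = s(ψ,γ)`, §3.3 p. 459),
  "We denote the representation on `Θ(γ, ψ, χ)` by `ω(γ, ψ, χ)` and call it a Weil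
  representation. Let `Ω` denote the set of all Weil representations." — the theta lift of the
  character `χ` of `U(1) ≅ Z` to `U(3)` for the splitting data `(γ, ψ)`;
* `packetA η η′` — the **A-packet** `Π(ρ) ⊆ Rep` of the automorphic character `ρ` of
  `H = U(2) × U(1)`, §1.4, p. 450: "`ρ((h₂, h₁)) = η(det(h₂)) η′(det(h₂) h₁)` where `η`, `η′` are
  automorphic characters of `E¹` and `h_j ∈ U(j)(𝔸)`"; "If `dim(ρ) = 1`, we let `Π(ρ)` denote the
  A-packet associated to `ρ`, as described in the Introduction" (p. 446 L3–8: "In [R], a certain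
  class of enlarged L-packets ([A]), or A-packets, … parametrized by automorphic characters `ρ` of
  the unique elliptic endoscopic group `H = U(2) × U(1)` for `G`. The A-packet `Π(ρ)` is the
  transfer of `ρ` with respect to functoriality for an embedding `ξ_H : ᴸH → ᴸG`. Of course,
  `Π(ρ)` is a 'tensor product' `⊗Π(ρ_v)`. For all `v`, `Π(ρ_v)` contains a certain non-tempered
  representation `π^n(ρ_v)`, and it contains an additional representation `π^s(ρ_v)` precisely
  when `v` remains prime in `E`."); = [Rogawski1990] §13.3 `Π(ξ)`, `ξ(h) = η(det₀(h)) ψ(det(h))`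
  with `ψ = η′`.
[cite: GelbartRogawski1991, §1.1–§1.4 pp. 449–451; §3.4 pp. 459–460; Introduction pp. 446–448] -/
structure GR91Spectrum : Type (u + 1) where
  /-- irreducible admissible representations of `G(𝔸)`, `G` the QUASI-SPLIT `U(3)` of `E/F` -/
  Rep : Type u
  /-- occurs discretely in `L²(G(F)\G(𝔸))` -/
  IsDiscrete : Rep → Prop
  /-- exceptional (Def 2.3.1) -/
  IsExceptional : Rep → Prop
  /-- `H¹(Lie(U), K, π_∞) ≠ 0` -/
  H1Nonzero : Rep → Prop
  /-- automorphic characters of `U(1) = E¹` (`η`, `η′`, `χ`) -/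
  Char1 : Type u
  [instCommGroup : CommGroup Char1]
  /-- Hecke characters `γ` of `E` with `γ|_{I_F} = ω_{E/F}` -/
  OmegaHecke : Type u
  /-- `ν • γ = γ ν_E` -/
  [instAction : MulAction Char1 OmegaHecke]
  /-- the fixed `μ` of `ξ_H` -/
  mu : OmegaHecke
  /-- `γ ↦ γ¹ = γ|_{𝔸_E¹}` -/
  res1 : OmegaHecke → Char1
  /-- non-trivial characters `ψ` of `F\𝔸` -/
  AddChar : Type u
  /-- `ψ′ = ψ^δ` for some `δ ∈ N_{E/F}(E*)` -/
  NormClassEq : AddChar → AddChar → Prop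
  /-- the Weil representation `ω(γ, ψ, χ)` -/
  weil : OmegaHecke → AddChar → Char1 → Rep
  /-- the A-packet `Π(ρ)`, `ρ((h₂,h₁)) = η(det h₂) η′(det(h₂) h₁)` -/
  packetA : Char1 → Char1 → Set Rep

attribute [instance] GR91Spectrum.instCommGroup GR91Spectrum.instAction

namespace GR91Spectrum

variable (X : GR91Spectrum.{u})

/-- The splitting character of (5.1.1) / (3.4.2) for `ρ = (η, η′)`: `γ = μ η_E η′_E`.
[cite: GelbartRogawski1991, Thm 5.1.1 (5.1.1), p. 465] -/
def gammaOf (η η' : X.Char1) : X.OmegaHecke := (η * η') • X.mu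

/-- The central character of (5.1.1) for `ρ = (η, η′)`: `χ = γ¹ η′`, `γ = μ η_E η′_E`.
[cite: GelbartRogawski1991, Thm 5.1.1 (5.1.1), p. 465] -/
def chiOf (η η' : X.Char1) : X.Char1 := X.res1 (X.gammaOf η η') * η'

/-- **P** "Let `Ω` be the set of representations of `G` in the image of the Howe correspondence for
`(U(1), U(3))`. They will be called Weil representations; all of them are discrete."  (Prop 3.4.1
(1)–(2): "`Θ(γ, ψ)` is contained in `L²(G(F)\G(𝔸))`. … the closure of `Θ(γ, ψ, χ)` in
`L²(G(F)\G(𝔸))` generates a non-zero irreducible automorphic representation.")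
[cite: GelbartRogawski1991, Introduction p. 446 L17–19, with Proposition 3.4.1, p. 459] -/
def weil_discrete (X : GR91Spectrum.{u}) : Prop :=
  ∀ (γ : X.OmegaHecke) (ψ : X.AddChar) (χ : X.Char1), X.IsDiscrete (X.weil γ ψ χ)

/-- **P** "Let `π = ω(γ, ψ, χ) ∈ Ω`. Then (a) `π ∈ Π(ρ)`, where
`ρ((h₂, h₁) = η(det(h₂)) η′(det(h₂) h₁)` [sic: one closing parenthesis missing in print] is
determined by the formulas: (3.4.2) `γ = μ η_E η′_E`, `χ(γ¹)⁻¹ = η′`".  Typed: for every `(η, η′)`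
satisfying the two formulas, `ω(γ,ψ,χ) ∈ Π(η, η′)` ("is determined by" = such `(η, η′)` exists and
is unique, which is not re-asserted here). [cite: GelbartRogawski1991, Theorem 3.4 (a), p. 461] -/
def thm34a (X : GR91Spectrum.{u}) : Prop :=
  ∀ (γ : X.OmegaHecke) (ψ : X.AddChar) (χ η η' : X.Char1),
    γ = (η * η') • X.mu → χ * (X.res1 γ)⁻¹ = η' → X.weil γ ψ χ ∈ X.packetA η η'

/-- **P** "Let `π = ω(γ, ψ, χ) ∈ Ω`. Then … (b) `π` is exceptional."
[cite: GelbartRogawski1991, Theorem 3.4 (b), p. 461] -/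
def thm34b (X : GR91Spectrum.{u}) : Prop :=
  ∀ (γ : X.OmegaHecke) (ψ : X.AddChar) (χ : X.Char1), X.IsExceptional (X.weil γ ψ χ)

/-- **P** "If `π` is exceptional, then `π` belongs to `Π(ρ)` for some automorphic character `ρ` of
`H`."  ("exceptional" is defined for discrete `π`, Def 2.3.1; the printed proof, p. 452: "By [R,
Theorem 13.3.6], if there exists a non-split place `v` of `F` such that `π_v = π^n(ρ_v)` for some
one-dimensional representation `ρ_v` of `H_v`, then `π ∈ Π(ρ)` for some automorphic character `ρ`
of `H`" — i.e. [Rogawski1990] Thm 13.3.6 (c), pp. 202–203.)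
[cite: GelbartRogawski1991, Theorem 2.4.1, p. 452] -/
def thm241 (X : GR91Spectrum.{u}) : Prop :=
  ∀ π : X.Rep, X.IsDiscrete π → X.IsExceptional π → ∃ η η' : X.Char1, π ∈ X.packetA η η'

/-- **P** "the representations `ω(γ, ψ, χ)` and `ω(γ′, ψ′, χ′)` are equivalent if and only if
`(γ′, ψ′, χ′) = (γ, ψ^δ, χ)` for some `δ ∈ N_{E/F}(E*)`"; p. 461: "we need only show that
`ω(γ, ψ, χ) = ω(γ′, ψ′, χ′)` if and only if `γ′ = γ`, `χ′ = χ`, and `ψ′ = ψ^δ` for some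
`δ ∈ N_{E/F}(E*)`. This is clear from the local bijection ([GR₁, Prop. 5.1.1]) …" (`Rep` =
isomorphism classes, so "equivalent" = `=`).  Also §3.2 Remark (3), p. 458: "`ω(ψ, γ)` depends
only on `ψ` modulo norms from `E`."
[cite: GelbartRogawski1991, Introduction p. 447 L6–8, and Remark after Theorem 3.4, p. 461] -/
def weil_eq_iff (X : GR91Spectrum.{u}) : Prop :=
  ∀ (γ γ' : X.OmegaHecke) (ψ ψ' : X.AddChar) (χ χ' : X.Char1),
    X.weil γ ψ χ = X.weil γ' ψ' χ' ↔ γ' = γ ∧ χ' = χ ∧ X.NormClassEq ψ ψ'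

/-- **P — THE THEOREM** "Let `π` be a discrete representation of `G`. Then the following are
equivalent: (a) `π` is a Weil representation `ω(γ, ψ, χ)`. (b) `π` is exceptional (c) `π ∈ Π(ρ)`
for some automorphic character `ρ` of `H`. If (a)–(c) hold, the relation between `(γ, χ)` and `ρ`
is: (5.1.1) `γ = μ η_E η′_E` and `χ = γ¹ η′`, where `γ¹` is the restriction of `γ` to the norm one
elements. In particular, `Π(ρ) = {ω(γ, ψ, χ)}`, where `ψ` runs through a set of representatives
for the characters of `F\𝔸` modulo `N_{E/F}(E*)`."  (`ρ` as in §5.1, p. 465: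
"`ρ((h₂, h₁)) = η(det(h₂)) η′(det(h₂) h₁)`".)  TYPED here: (a) ⟺ (c) for discrete `π`, and the
relation; (b) is `thm511_b`; the "In particular" clause — for the DISCRETE members, as the
Introduction states it (p. 447 L11–14, quoted at `discreteMembers_eq`) — is DERIVED below.  Remark
(ibid.): "In terms of Langlands functoriality, this result says that for fixed `γ`, the set of
theta-liftings of `χ`, relative to the splittings determined by `(γ, ψ)`, coincides with the
A-packet obtained as the endoscopic transfer of the following one-dimensional representation `ρ`
of `H`. Let `ρ₂` be the character of `E¹` such that `ρ₂(z/z̄) = μ⁻¹γ(z)` for `z ∈ E*` and let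
`ρ₁(z) = χ(γ¹)⁻¹(z)`. Then `ρ((h₂, h₁)) = ρ₂(det(h₂)) ρ₁(h₁)`."  Printed inputs of the proof
(pp. 465–466): the Shimura-integral identity (5.1.2) for cuspidal `π`, [R] Thm 13.3.6, the
multiplicity rule "[R₂, Theorem 1.1]" (p. 446: "an element `π` of `Π(ρ)` is discrete … if and only
if `(−1)^{|X|} = ε(½, φ)`", `X = {v : π_v = π^s(ρ)}`), Lemma 5.1.2 and "multiplicity one for `G`
([R])". [cite: GelbartRogawski1991, Theorem 5.1.1, p. 465] -/
def thm511 (X : GR91Spectrum.{u}) : Prop :=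
  ∀ π : X.Rep, X.IsDiscrete π →
    ((∃ (γ : X.OmegaHecke) (ψ : X.AddChar) (χ : X.Char1), π = X.weil γ ψ χ) ↔
        ∃ η η' : X.Char1, π ∈ X.packetA η η') ∧
      ∀ (γ : X.OmegaHecke) (ψ : X.AddChar) (χ η η' : X.Char1),
        π = X.weil γ ψ χ → π ∈ X.packetA η η' → γ = (η * η') • X.mu ∧ χ = X.res1 γ * η'

/-- **P** — the clause of Theorem 5.1.1 through the posited predicate `IsExceptional` (Def 2.3.1):
for discrete `π`, Weil ⟺ exceptional ⟺ in some `Π(ρ)`.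
[cite: GelbartRogawski1991, Theorem 5.1.1 (a) ⟺ (b) ⟺ (c), p. 465] -/
def thm511_b (X : GR91Spectrum.{u}) : Prop :=
  ∀ π : X.Rep, X.IsDiscrete π →
    ((∃ (γ : X.OmegaHecke) (ψ : X.AddChar) (χ : X.Char1), π = X.weil γ ψ χ) ↔ X.IsExceptional π) ∧
      (X.IsExceptional π ↔ ∃ η η' : X.Char1, π ∈ X.packetA η η')

/-- **P-INTRO** (a sentence of the Introduction, printed as a CONSEQUENCE of the paper's results and
of [R]; not a numbered theorem): "For `U = U(3)`, the results of this paper, together with the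
characterization of representations `π` with non-trivial `H¹` in [R], show that every discrete `π`
with `H¹(Lie(U), K, π_∞) ≠ 0` is a Weil representation."  ([R] = [Rogawski1990] §15.3 p. 249 with
Prop 15.2.1 (b) and Thm 13.3.6 (c): a discrete `π` with `π_v = J_φ^±` at an archimedean `v` lies in
some `Π(ξ)`, `dim ξ = 1`.)  Context (ibid. L24–30): "The Weil representations arising from the pair
`(U(1), U)` … have been studied by Kazhdan [K₂] and Borel–Wallach [BW] in the anisotropic case and
by Shimura [S₁] in the general case. … the Weil representations `π` are often such that
`H¹(Lie(U), K, π_∞) ≠ 0`." [cite: GelbartRogawski1991, Introduction, p. 448 L30–33] -/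
def intro_h1_weil (X : GR91Spectrum.{u}) : Prop :=
  ∀ π : X.Rep, X.IsDiscrete π → X.H1Nonzero π →
    ∃ (γ : X.OmegaHecke) (ψ : X.AddChar) (χ : X.Char1), π = X.weil γ ψ χ

/-! ### Derived statements (kernel) -/

/-- K.  The relation (5.1.1) solved for `(γ, χ)`: for `ρ = (η, η′)`, `γ = μ η_E η′_E` and `χ = γ¹ η′`
satisfy the two formulas of Thm 3.4 (a), so `ω(γ, ψ, χ) ∈ Π(ρ)` for EVERY `ψ`.
[cite: GelbartRogawski1991, Theorem 3.4 (a), p. 461] -/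
theorem weil_mem_packetA (h34 : X.thm34a) (η η' : X.Char1) (ψ : X.AddChar) :
    X.weil (X.gammaOf η η') ψ (X.chiOf η η') ∈ X.packetA η η' :=
  h34 _ ψ _ η η' rfl (by simp [chiOf])

/-- K.  A discrete member of `Π(ρ)` is a Weil representation `ω(γ, ψ, χ)` with `(γ, χ)` given by
(5.1.1) (Thm 5.1.1 (c) ⇒ (a) together with the relation).
[cite: GelbartRogawski1991, Theorem 5.1.1, p. 465] -/
theorem exists_weil_of_mem (h511 : X.thm511) {π : X.Rep} (hd : X.IsDiscrete π) {η η' : X.Char1}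
    (hπ : π ∈ X.packetA η η') : ∃ ψ : X.AddChar, π = X.weil (X.gammaOf η η') ψ (X.chiOf η η') := by
  obtain ⟨hiff, hrel⟩ := h511 π hd
  obtain ⟨γ, ψ, χ, rfl⟩ := hiff.2 ⟨η, η', hπ⟩
  obtain ⟨hγ, hχ⟩ := hrel γ ψ χ η η' rfl hπ
  refine ⟨ψ, ?_⟩
  subst hγ
  simp [gammaOf, chiOf, hχ]

/-- **K — the Introduction's statement of the main result**: "there is a simple correspondence
between the set of pairs `(γ, χ)` and the set of automorphic characters `ρ` of `H`, and we show that
the set of discrete members of `Π(ρ)` consists precisely of the representations `ω(γ, ψ, χ)`, where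
`ψ` ranges over a set of representatives for the characters of `F\𝔸` modulo the action of
`N_{E/F}(E*)`" — DERIVED from the verbatim `weil_discrete` (p. 446 / Prop 3.4.1), `thm34a` (Thm 3.4
(a)) and `thm511` (Thm 5.1.1), with the correspondence `ρ = (η, η′) ↦ (γ, χ) = (μ η_E η′_E, γ¹ η′)`
of (5.1.1).  (Representatives modulo norms: by `weil_eq_iff`, `ψ` and `ψ^δ`, `δ ∈ N_{E/F}(E*)`,
give the same member.) [cite: GelbartRogawski1991, Introduction, p. 447 L9–14] -/
theorem discreteMembers_eq (hdisc : X.weil_discrete) (h34 : X.thm34a) (h511 : X.thm511)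
    (η η' : X.Char1) :
    {π : X.Rep | X.IsDiscrete π ∧ π ∈ X.packetA η η'} =
      {π : X.Rep | ∃ ψ : X.AddChar, π = X.weil (X.gammaOf η η') ψ (X.chiOf η η')} := by
  ext π
  simp only [Set.mem_setOf_eq]
  constructor
  · rintro ⟨hd, hπ⟩
    exact X.exists_weil_of_mem h511 hd hπ
  · rintro ⟨ψ, rfl⟩
    exact ⟨hdisc _ _ _, X.weil_mem_packetA h34 η η' ψ⟩

/-- K.  With the Introduction's `H¹` sentence: every discrete `π` with `H¹(Lie(U), K, π_∞) ≠ 0`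
lies in some A-packet `Π(ρ)` AND is the Weil representation `ω(μ η_E η′_E, ψ, γ¹ η′)` for that
`ρ = (η, η′)` and some `ψ`.
[cite: GelbartRogawski1991, Introduction p. 448 L30–33, with Theorem 5.1.1, p. 465] -/
theorem exists_packet_and_weil_of_h1 (hH1 : X.intro_h1_weil) (h511 : X.thm511) {π : X.Rep}
    (hd : X.IsDiscrete π) (h1 : X.H1Nonzero π) :
    ∃ η η' : X.Char1, π ∈ X.packetA η η' ∧
      ∃ ψ : X.AddChar, π = X.weil (X.gammaOf η η') ψ (X.chiOf η η') := by
  obtain ⟨γ, ψ, χ, hπ⟩ := hH1 π hd h1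
  obtain ⟨η, η', hmem⟩ := (h511 π hd).1.1 ⟨γ, ψ, χ, hπ⟩
  exact ⟨η, η', hmem, X.exists_weil_of_mem h511 hd hmem⟩

/-- K (transparency of the two typings of Thm 5.1.1).  `thm511_b` ((a) ⟺ (b) ⟺ (c)) implies the
`IsExceptional`-free equivalence (a) ⟺ (c) — the first conjunct of `thm511`.
[cite: GelbartRogawski1991, Theorem 5.1.1, p. 465] -/
theorem weil_iff_mem_of_thm511_b (h : X.thm511_b) (π : X.Rep) (hd : X.IsDiscrete π) :
    (∃ (γ : X.OmegaHecke) (ψ : X.AddChar) (χ : X.Char1), π = X.weil γ ψ χ) ↔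
      ∃ η η' : X.Char1, π ∈ X.packetA η η' :=
  ((h π hd).1).trans (h π hd).2

/-- K.  Thm 2.4.1 is the implication (b) ⇒ (c) of Thm 5.1.1 (recorded so that the logical status is
transparent). [cite: GelbartRogawski1991, Theorem 2.4.1, p. 452; Theorem 5.1.1, p. 465] -/
theorem thm241_of_thm511_b (h : X.thm511_b) : X.thm241 :=
  fun π hd hexc => ((h π hd).2).1 hexc

end GR91Spectrum

end Literature.NumberTheory.GelbartRogawski1991

end
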